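import Mathlib
import HarnessLib
import Literature.Analysis.ValidatedNumerics.KroneckerDotProduct
import Summits.RiemannHypothesis.RiemannHypothesis.Theorems.IntegerScrewRungCertWideCheck

/-!
# Route `IntegerScrew` — kernel certificate checker for the finite rungs: the Gram products by KRONECKER SUBSTITUTION

The wide rung checker (`IntegerScrewRungCertWide` / `…WideCheck`) decides `S_{N+1} = screwMatrix N ≻ 0` from a table of
enclosures `utab` and an integer factor `Lz` by the integer domination test of Rump's perturbation lemma; its STREAMED row
tests `zrowS` spend almost all of their kernel time in the `≈ N³/3` integer multiply–adds of the Gram products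
`(L Lᵀ)_{ij} = dotZ Lᵢ Lⱼ` (`≈ 133 s` of kernel time at `N = 127`, eight `decide +kernel` chunks of `IntegerScrewRung128`;
`≈ 1 000 s` at `N = 255`).  Measured on the gate farm (this seat, 2026-08-25): a kernel `Nat` operation costs the same
`≈ 20–80 µs` whether its operands have 6 or 20 000 bits — the unit of cost is the reduction step, not the arithmetic.  Hence
the classical KRONECKER SUBSTITUTION [cite: GathenGerhard2013ModernComputerAlgebra, §8.4] as typed in the tree
(`Literature.Analysis.ValidatedNumerics.KroneckerDot.kdotN_packN_packRevN`: ONE big product, one division, one remainder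
per dot product of natural-number vectors): here

* `posPart` / `negPart` / `KRec` / `mkKRec W n row` — the ±-split of a signed row and its four packs (computed ONCE per row);
* `kdotZ W n X Y` — the signed dot product as FOUR `kdotN`s; ★ `kdotZ_mkKRec`: `= dotZ a b` for rows of length `≤ n`,
  `|entries| ≤ Mx`, `n·Mx·Mx < W`;
* `rowFoldK` / `zrowSK` / **`zcheckRowsK N utab Lz lamZ W Mx i₀ cnt`** — the streamed row tests of `…WideCheck` with every
  `dotZ` replaced by `kdotZ` on the packed rows (the packs `Lz.map (mkKRec W N)` are shared by all rows of a chunk), guarded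
  by the shape / entry-size / capacity checks that make the replacement exact;
* soundness ★ `zrowW_of_rowsK` — a passed chunk decides its rows in the indexed form consumed UNCHANGED by
  `posDef_of_rungW` / `screwPivot_pos_of_rungW` / `RungCert.quadForm_ge_of_rungW` (via `rowFoldK_eq`, `zrowSK_eq_zrowS`,
  `zrowW_of_zrowS`).

Cost at `N = 127` (farm): the whole domination test in ONE chunk of a few seconds instead of eight.  Nothing here bears on the
truth of RH (every rung is an RH-consequence made unconditional by computation).  References: J. von zur Gathen, J. Gerhard,
Modern Computer Algebra, 3rd ed. (2013) §8.4 [GathenGerhard2013ModernComputerAlgebra]; S. M. Rump, Acta Numerica 19 (2010)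
§10.8 [folklore]; M. Suzuki, J. Lond. Math. Soc. (2) 108 (2023), (1.1), (1.4) [Suzuki2023].
-/

set_option linter.dupNamespace false
set_option autoImplicit false

namespace Summit.RiemannHypothesis.RiemannHypothesis.Theorems.IntegerScrew.RungCert

open Literature.NumberTheory.LFunctions Literature.Analysis.ValidatedNumerics Finset
open Literature.Analysis.ValidatedNumerics.Numerics Literature.Analysis.ValidatedNumerics.KroneckerDot
open scoped BigOperators

/-! ## Signed dot products by four Kronecker products -/

/-- Positive parts `a ↦ a⁺` of a signed row (as naturals). [folklore] -/
def posPart : List ℤ → List ℕ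
  | [] => []
  | a :: as => a.toNat :: posPart as

/-- Negative parts `a ↦ a⁻` of a signed row (as naturals). [folklore] -/
def negPart : List ℤ → List ℕ
  | [] => []
  | a :: as => (-a).toNat :: negPart as

/-- The per-row record: `packN` and `packRevN` of the positive and of the negative parts.
[cite: GathenGerhard2013ModernComputerAlgebra, §8.4] -/
structure KRec where
  /-- `packN W a⁺` -/
  pP : ℕ
  /-- `packN W a⁻` -/
  pM : ℕ
  /-- `packRevN W n a⁺` -/
  rP : ℕ
  /-- `packRevN W n a⁻` -/
  rM : ℕ

/-- Pack a signed row once (slot base `W`, padded length `n`). [cite: GathenGerhard2013ModernComputerAlgebra, §8.4] -/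
def mkKRec (W n : ℕ) (a : List ℤ) : KRec :=
  ⟨packN W (posPart a), packN W (negPart a), packRevN W n (posPart a), packRevN W n (negPart a)⟩

/-- **The signed Kronecker dot product**: `Σ a⁺b⁺ + Σ a⁻b⁻ − (Σ a⁺b⁻ + Σ a⁻b⁺)`, each sum ONE `kdotN`.
[cite: GathenGerhard2013ModernComputerAlgebra, §8.4] -/
def kdotZ (W n : ℕ) (X Y : KRec) : ℤ :=
  ((kdotN W n X.pP Y.rP + kdotN W n X.pM Y.rM : ℕ) : ℤ) - ((kdotN W n X.pP Y.rM + kdotN W n X.pM Y.rP : ℕ) : ℤ)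

/-- Every entry of every row has `|entry| ≤ Mx` (kernel check). [folklore] -/
def absBoundOK (Mx : ℕ) (Lz : List (List ℤ)) : Bool :=
  Lz.all fun row => row.all fun a => decide (a.natAbs ≤ Mx)

/-- Lengths. [folklore] -/
theorem length_posPart : ∀ a : List ℤ, (posPart a).length = a.length
  | [] => rfl
  | _ :: as => by simp [posPart, length_posPart as]

/-- Lengths. [folklore] -/
theorem length_negPart : ∀ a : List ℤ, (negPart a).length = a.length
  | [] => rfl
  | _ :: as => by simp [negPart, length_negPart as]

/-- Entries: `a_m = a⁺_m − a⁻_m` (zero-padded). [folklore] -/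
theorem getD_eq_posPart_sub_negPart : ∀ (a : List ℤ) (m : ℕ),
    a.getD m 0 = ((posPart a).getD m 0 : ℤ) - ((negPart a).getD m 0 : ℤ)
  | [], m => by simp [posPart, negPart]
  | x :: xs, 0 => by
      simp only [posPart, negPart, List.getD_cons_zero]
      omega
  | x :: xs, m + 1 => by
      simp only [posPart, negPart, List.getD_cons_succ]
      exact getD_eq_posPart_sub_negPart xs m

/-- Entries of the positive part are bounded by the absolute values. [folklore] -/
theorem posPart_le {Mx : ℕ} : ∀ {a : List ℤ}, (∀ x ∈ a, x.natAbs ≤ Mx) → ∀ y ∈ posPart a, y ≤ Mx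
  | [], _, y, hy => by simp [posPart] at hy
  | x :: xs, h, y, hy => by
      simp only [posPart, List.mem_cons] at hy
      rcases hy with rfl | hy
      · have := h x (by simp); omega
      · exact posPart_le (fun z hz => h z (by simp [hz])) y hy

/-- Entries of the negative part are bounded by the absolute values. [folklore] -/
theorem negPart_le {Mx : ℕ} : ∀ {a : List ℤ}, (∀ x ∈ a, x.natAbs ≤ Mx) → ∀ y ∈ negPart a, y ≤ Mx
  | [], _, y, hy => by simp [negPart] at hy
  | x :: xs, h, y, hy => by
      simp only [negPart, List.mem_cons] at hy
      rcases hy with rfl | hy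
      · have := h x (by simp); omega
      · exact negPart_le (fun z hz => h z (by simp [hz])) y hy

/-- ★ **The signed Kronecker dot product is the dot product**: rows of length `≤ n` (`1 ≤ n`), entries `|·| ≤ Mx`,
capacity `n·Mx·Mx < W`. [cite: GathenGerhard2013ModernComputerAlgebra, §8.4] -/
theorem kdotZ_mkKRec {W n Mx : ℕ} (hn : 1 ≤ n) {a b : List ℤ} (ha : a.length ≤ n) (hb : b.length ≤ n)
    (hMa : ∀ x ∈ a, x.natAbs ≤ Mx) (hMb : ∀ x ∈ b, x.natAbs ≤ Mx) (hcap : n * Mx * Mx < W) :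
    kdotZ W n (mkKRec W n a) (mkKRec W n b) = dotZ a b := by
  have hap : (posPart a).length ≤ n := by rw [length_posPart]; exact ha
  have han : (negPart a).length ≤ n := by rw [length_negPart]; exact ha
  have hbp : (posPart b).length ≤ n := by rw [length_posPart]; exact hb
  have hbn : (negPart b).length ≤ n := by rw [length_negPart]; exact hb
  unfold kdotZ mkKRec
  simp only
  rw [kdotN_packN_packRevN hn hap hbp (posPart_le hMa) (posPart_le hMb) hcap,
    kdotN_packN_packRevN hn han hbn (negPart_le hMa) (negPart_le hMb) hcap,
    kdotN_packN_packRevN hn hap hbn (posPart_le hMa) (negPart_le hMb) hcap,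
    kdotN_packN_packRevN hn han hbp (negPart_le hMa) (posPart_le hMb) hcap,
    dotZ_eq_sum a b n (Or.inl ha)]
  push_cast
  rw [← Finset.sum_add_distrib, ← Finset.sum_add_distrib, ← Finset.sum_sub_distrib]
  refine Finset.sum_congr rfl fun m _ => ?_
  rw [getD_eq_posPart_sub_negPart a m, getD_eq_posPart_sub_negPart b m]
  ring

/-! ## The streamed row tests with packed Gram products -/

/-- The row accumulator of `rowFold` with `dotZ Lᵢ Lⱼ` replaced by `kdotZ` on the packed rows. [folklore] -/
def rowFoldK (W n : ℕ) (Ki : KRec) (lamZ : ℤ) (i : ℕ) : ℕ → List FI → List KRec → ℤ → ℤ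
  | j, t :: ts, Kj :: Ks, acc =>
      rowFoldK W n Ki lamZ i (j + 1) ts Ks
        (acc + (if j = i then 0 else |(t.lo + t.hi) * 32768 - kdotZ W n Ki Kj - (if i = j then lamZ * 32768 else 0)|) +
          32768 * (t.hi - t.lo))
  | _, _, _, acc => acc

/-- **Streamed row test `i` with packed Gram products** (`Ks` = the packed rows, `D = dcol utab`). [folklore] -/
def zrowSK (W n : ℕ) (utab : List (List FI)) (D : List FI) (Ks : List KRec) (lamZ : ℤ) (i : ℕ) : Bool :=
  let tr := trowD utab D i
  let Ki := Ks.getD i (mkKRec W n [])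
  let ti := tr.getD i (FI.ofInt 0)
  decide (rowFoldK W n Ki lamZ i 0 tr Ks 0 ≤ (ti.lo + ti.hi) * 32768 - kdotZ W n Ki Ki - lamZ * 32768)

/-- **A chunk of packed row tests**, rows `i₀ ≤ i < i₀ + cnt`: the shape guards of `zcheckRowsS`, the factor-row guards
(`lzOK`: lengths `≤ N`; `absBoundOK`: entries `≤ Mx`; capacity `N·Mx·Mx < W`), the rows packed ONCE, then the row tests.
[folklore] -/
def zcheckRowsK (N : ℕ) (utab : List (List FI)) (Lz : List (List ℤ)) (lamZ : ℤ) (W Mx i₀ cnt : ℕ) : Bool :=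
  let D := dcol utab
  let Ks := Lz.map (mkKRec W N)
  decide (utab.length = N + 2) && decide (Lz.length = N) && decide (0 < N) && lzOK Lz N && absBoundOK Mx Lz &&
    decide (N * Mx * Mx < W) && rall cnt fun t => zrowSK W N utab D Ks lamZ (i₀ + t)

/-- What `lzOK` certifies, by membership. [folklore] -/
theorem length_le_of_mem_lzOK {Lz : List (List ℤ)} {n : ℕ} (h : lzOK Lz n = true) {row : List ℤ} (hr : row ∈ Lz) :
    row.length ≤ n := by
  simpa using List.all_eq_true.1 h row hr

/-- What `absBoundOK` certifies, by membership. [folklore] -/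
theorem abs_le_of_mem_absBoundOK {Mx : ℕ} {Lz : List (List ℤ)} (h : absBoundOK Mx Lz = true) {row : List ℤ}
    (hr : row ∈ Lz) : ∀ x ∈ row, x.natAbs ≤ Mx := fun x hx => by
  simpa using List.all_eq_true.1 (List.all_eq_true.1 h row hr) x hx

/-- `Lz.getD i []` is a row of `Lz` or the empty row. [folklore] -/
theorem getD_mem_or_nil (Lz : List (List ℤ)) (i : ℕ) : Lz.getD i [] ∈ Lz ∨ Lz.getD i [] = [] := by
  rw [List.getD_eq_getElem?_getD]
  cases hi : Lz[i]? with
  | none => exact Or.inr rfl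
  | some row => exact Or.inl (List.mem_of_getElem? hi)

/-- **The packed accumulator is the accumulator**: every pair `(Lᵢ, Lⱼ)` met along the fold satisfies the hypotheses
of `kdotZ_mkKRec`. [folklore] -/
theorem rowFoldK_eq {W N Mx : ℕ} (hN : 1 ≤ N) (hcap : N * Mx * Mx < W) {Li : List ℤ} (hLi : Li.length ≤ N)
    (hMi : ∀ x ∈ Li, x.natAbs ≤ Mx) (lamZ : ℤ) (i : ℕ) :
    ∀ (ts : List FI) (Ls : List (List ℤ)), (∀ row ∈ Ls, row.length ≤ N ∧ ∀ x ∈ row, x.natAbs ≤ Mx) →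
      ∀ (j : ℕ) (acc : ℤ),
        rowFoldK W N (mkKRec W N Li) lamZ i j ts (Ls.map (mkKRec W N)) acc = rowFold Li lamZ i j ts Ls acc
  | [], [], _, j, acc => by simp [rowFoldK, rowFold]
  | [], _ :: _, _, j, acc => by simp [rowFoldK, rowFold]
  | _ :: _, [], _, j, acc => by simp [rowFoldK, rowFold]
  | t :: ts, Lj :: Ls, hLs, j, acc => by
      have hj := hLs Lj (by simp)
      have ih := rowFoldK_eq hN hcap hLi hMi lamZ i ts Ls (fun row hrow => hLs row (by simp [hrow]))
      simp only [List.map_cons, rowFoldK, rowFold]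
      rw [kdotZ_mkKRec hN hLi hj.1 hMi hj.2 hcap, ih]

/-- **The packed row test is the streamed row test** of `…WideCheck` (under the guards of `zcheckRowsK`). [folklore] -/
theorem zrowSK_eq_zrowS {W N Mx : ℕ} {Lz : List (List ℤ)} (hN : 1 ≤ N) (hlz : lzOK Lz N = true)
    (hab : absBoundOK Mx Lz = true) (hcap : N * Mx * Mx < W) (utab : List (List FI)) (D : List FI) (lamZ : ℤ)
    (i : ℕ) : zrowSK W N utab D (Lz.map (mkKRec W N)) lamZ i = zrowS utab D Lz lamZ i := by
  have hLi : (Lz.getD i []).length ≤ N := length_le_of_lzOK hlz i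
  have hMi : ∀ x ∈ Lz.getD i [], x.natAbs ≤ Mx := by
    rcases getD_mem_or_nil Lz i with h | h
    · exact abs_le_of_mem_absBoundOK hab h
    · rw [h]; simp
  have hLs : ∀ row ∈ Lz, row.length ≤ N ∧ ∀ x ∈ row, x.natAbs ≤ Mx :=
    fun row hrow => ⟨length_le_of_mem_lzOK hlz hrow, abs_le_of_mem_absBoundOK hab hrow⟩
  unfold zrowSK zrowS
  simp only [List.getD_map, rowFoldK_eq hN hcap hLi hMi lamZ i _ Lz hLs,
    kdotZ_mkKRec hN hLi hLi hMi hMi hcap]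

/-- ★ **A packed chunk decides its rows** (in the indexed form consumed by `posDef_of_rungW`,
`screwPivot_pos_of_rungW`, `RungCert.quadForm_ge_of_rungW`). [folklore] -/
theorem zrowW_of_rowsK {N : ℕ} {utab : List (List FI)} {Lz : List (List ℤ)} {lamZ : ℤ} {W Mx i₀ cnt : ℕ}
    (h : zcheckRowsK N utab Lz lamZ W Mx i₀ cnt = true) {i : ℕ} (h1 : i₀ ≤ i) (h2 : i < i₀ + cnt) (hi : i < N) :
    zrowW N utab Lz lamZ i = true := by
  simp only [zcheckRowsK, Bool.and_eq_true, decide_eq_true_eq] at h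
  obtain ⟨⟨⟨⟨⟨⟨hlen, hLz⟩, hNpos⟩, hlz⟩, hab⟩, hcap⟩, hall⟩ := h
  obtain ⟨t, rfl⟩ : ∃ t, i = i₀ + t := ⟨i - i₀, by omega⟩
  have ht := of_rall hall (k := t) (by omega)
  rw [zrowSK_eq_zrowS hNpos hlz hab hcap] at ht
  exact zrowW_of_zrowS hlen hLz hi ht

/-- All rows from packed chunks covering `0 … N−1` ⇒ every indexed row test (convenience form for ONE chunk). [folklore] -/
theorem zrowW_all_of_rowsK {N : ℕ} {utab : List (List FI)} {Lz : List (List ℤ)} {lamZ : ℤ} {W Mx : ℕ}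
    (h : zcheckRowsK N utab Lz lamZ W Mx 0 N = true) : ∀ i < N, zrowW N utab Lz lamZ i = true :=
  fun i hi => zrowW_of_rowsK h (Nat.zero_le i) (by omega) hi

end Summit.RiemannHypothesis.RiemannHypothesis.Theorems.IntegerScrew.RungCert
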